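import Literature.Topology.PlaneTopology.ArgumentIncrement
import Mathlib.MeasureTheory.Integral.IntervalIntegral.FundThmCalculus
import Mathlib.Analysis.SpecialFunctions.ExpDeriv
import HarnessLib

/-!
# The winding number as the integral of the logarithmic derivative

Topic: Analysis / Complex (companion to `Literature/Topology/PlaneTopology/WindingNumber.lean` and
`ArgumentIncrement.lean`, where the winding number `wind f ∈ ℤ` of a loop `f : ℝ → ℂ` read on
`[0, 1]` and the increment `logInc f` of a continuous logarithm are defined topologically, via
continuous logarithms).

For a `C¹` nowhere-vanishing `f : ℝ → ℂ` the primitive `t ↦ log f(0) + ∫₀ᵗ f′/f` is a continuous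
logarithm of `f` (`exp_log_add_integral_deriv_div`), hence

* `integral_deriv_div_eq_logInc` — `∫₀¹ f′(t)/f(t) dt = logInc f`;
* `integral_deriv_div_eq_wind_mul` — for a loop (`f 0 = f 1`), `∫₀¹ f′/f = 2πi · wind f`: the
  analytic winding number `(2πi)⁻¹ ∮_f dz/z` is the topological one (the description "or
  `(2πi)⁻¹ ∮ dz/z` along `f` when `f` is rectifiable" in the docstring of `wind`);
* `exists_int_integral_deriv_div_eq` — in particular `∮_f dz/z ∈ 2πi ℤ`.

The derivative is given as a function `f′` with `HasDerivAt f (f′ t) t` for all `t` and `f′`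
continuous (e.g. `f′ = deriv f` for `ContDiff ℝ 1 f`, `integral_deriv_div_eq_wind_mul_of_contDiff`).
Everything is proved; all statements are folklore (Ahlfors, *Complex Analysis*, 3rd ed., §4.2.1,
Lemma 1: "the winding number `n(γ, a) = (2πi)⁻¹ ∫_γ dz/(z − a)` is an integer", proved there by
exactly this primitive).
-/

noncomputable section

open Set MeasureTheory intervalIntegral
open _root_.Complex
open scoped Real
open Literature.Topology.PlaneTopology

namespace Literature.Analysis.Complex

variable {f f' : ℝ → ℂ}

/-- A function with a derivative everywhere is continuous. [folklore] -/
theorem continuous_of_hasDerivAt (hf : ∀ t, HasDerivAt f (f' t) t) : Continuous f :=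
  continuous_iff_continuousAt.2 fun t => (hf t).continuousAt

/-- The logarithmic derivative `f′/f` of a nowhere-vanishing `C¹` function is continuous.
[folklore] -/
theorem continuous_deriv_div (hf : ∀ t, HasDerivAt f (f' t) t) (hf' : Continuous f')
    (h0 : ∀ t, f t ≠ 0) : Continuous fun t => f' t / f t :=
  hf'.div (continuous_of_hasDerivAt hf) h0

/-- **Integrating the logarithmic derivative gives a logarithm**: for a nowhere-vanishing `C¹`
function `f : ℝ → ℂ`, `exp (log f(0) + ∫₀ᵗ f′/f) = f(t)` for all `t` (the function
`f · exp(−∫₀ᵗ f′/f)` has derivative `0`). [folklore] -/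
theorem exp_log_add_integral_deriv_div (hf : ∀ t, HasDerivAt f (f' t) t) (hf' : Continuous f')
    (h0 : ∀ t, f t ≠ 0) (t : ℝ) :
    exp (log (f 0) + ∫ s in (0:ℝ)..t, f' s / f s) = f t := by
  set F : ℝ → ℂ := fun u => ∫ s in (0:ℝ)..u, f' s / f s with hF
  have hq : Continuous fun s => f' s / f s := continuous_deriv_div hf hf' h0
  have hFd : ∀ u, HasDerivAt F (f' u / f u) u := fun u =>
    (hq.integral_hasStrictDerivAt 0 u).hasDerivAt
  -- `g = f · exp (−F)` is constant
  set g : ℝ → ℂ := fun u => f u * exp (-F u) with hg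
  have hgd : ∀ u, HasDerivAt g 0 u := by
    intro u
    have h1 : HasDerivAt (fun v => exp (-F v)) (exp (-F u) * (-(f' u / f u))) u :=
      (hFd u).neg.cexp
    have h2 := (hf u).mul h1
    have e : f' u * exp (-F u) + f u * (exp (-F u) * -(f' u / f u)) = 0 := by
      field_simp [h0 u]
      ring
    rwa [e] at h2
  have hgconst : ∀ u, g u = g 0 := fun u =>
    is_const_of_deriv_eq_zero (fun v => (hgd v).differentiableAt) (fun v => (hgd v).deriv) u 0
  have hg0 : g 0 = f 0 := by
    simp [hg, hF]
  have hgt : f t * exp (-F t) = f 0 := (hgconst t).trans hg0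
  calc exp (log (f 0) + F t) = f 0 * exp (F t) := by rw [exp_add, exp_log (h0 0)]
    _ = f t * exp (-F t) * exp (F t) := by rw [hgt]
    _ = f t := by rw [mul_assoc, ← exp_add, neg_add_cancel, exp_zero, mul_one]

/-- **`∫₀¹ f′/f = logInc f`** for a nowhere-vanishing `C¹` function `f : ℝ → ℂ`: the integral of
the logarithmic derivative is the increment of (any) continuous logarithm along `[0, 1]`.
[folklore] -/
theorem integral_deriv_div_eq_logInc (hf : ∀ t, HasDerivAt f (f' t) t) (hf' : Continuous f')
    (h0 : ∀ t, f t ≠ 0) : (∫ s in (0:ℝ)..1, f' s / f s) = logInc f := by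
  have hq : Continuous fun s => f' s / f s := continuous_deriv_div hf hf' h0
  have hl : Continuous fun u => log (f 0) + ∫ s in (0:ℝ)..u, f' s / f s :=
    continuous_const.add (continuous_primitive hq.intervalIntegrable 0)
  rw [logInc_eq hl.continuousOn (fun t _ => exp_log_add_integral_deriv_div hf hf' h0 t)]
  simp

/-- **The analytic winding number is the topological one**: for a nowhere-vanishing `C¹` loop
`f : ℝ → ℂ` (`f 0 = f 1`), `∫₀¹ f′(t)/f(t) dt = 2πi · wind f`. [folklore] -/
theorem integral_deriv_div_eq_wind_mul (hf : ∀ t, HasDerivAt f (f' t) t) (hf' : Continuous f')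
    (h0 : ∀ t, f t ≠ 0) (h01 : f 0 = f 1) :
    (∫ s in (0:ℝ)..1, f' s / f s) = wind f * (2 * π * I) := by
  rw [integral_deriv_div_eq_logInc hf hf' h0]
  exact logInc_eq_wind_mul ⟨(continuous_of_hasDerivAt hf).continuousOn, fun t _ => h0 t, h01⟩

/-- **`∮ dz/z ∈ 2πi ℤ`** along every nowhere-vanishing `C¹` loop `f : ℝ → ℂ`. [folklore] -/
theorem exists_int_integral_deriv_div_eq (hf : ∀ t, HasDerivAt f (f' t) t) (hf' : Continuous f')
    (h0 : ∀ t, f t ≠ 0) (h01 : f 0 = f 1) :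
    ∃ n : ℤ, (∫ s in (0:ℝ)..1, f' s / f s) = n * (2 * π * I) :=
  ⟨wind f, integral_deriv_div_eq_wind_mul hf hf' h0 h01⟩

/-- `deriv` form: for `f : ℝ → ℂ` of class `C¹`, nowhere vanishing, with `f 0 = f 1`,
`∫₀¹ (deriv f t) / f t dt = 2πi · wind f`. [folklore] -/
theorem integral_deriv_div_eq_wind_mul_of_contDiff (hf : ContDiff ℝ 1 f) (h0 : ∀ t, f t ≠ 0)
    (h01 : f 0 = f 1) :
    (∫ s in (0:ℝ)..1, deriv f s / f s) = wind f * (2 * π * I) :=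
  integral_deriv_div_eq_wind_mul (fun t => ((hf.differentiable one_ne_zero) t).hasDerivAt)
    (hf.continuous_deriv le_rfl) h0 h01

end Literature.Analysis.Complex

end
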